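import Summits.QuantumFields.BalabanUV.Beta.FP.KernelPeriodisationFibLoc

/-!
# `BalabanUV.Beta.FP.KernelPeriodisationCopySums` — road «FP» (binder row D1), ROUTE T (β1), (R1): **THE GENERIC BRIDGE OF THE SECOND-ORDER 𝔔-JUNCTION** — for a
# two-bond family `W u u′` of lattice kernels that is JOINTLY covariant under the period lattice `Tℤ^{d+1}` (bonds and kernel arguments translated together), the
# ALL-PAIRS-OF-COPIES triple sum read at `(X, Z + T∘m)` (F5-Sym's torus bi-member, J-NOTE-7 §4's `G_T`) IS the `perZ ∘ dper` periodisation of the SECOND-BOND COPY SUM: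
# `Σ'_{m₁} Σ'_{m₂} Σ'_m W (u+T∘m₁) (u′+T∘m₂) X (Z+T∘m) a b = perZ T (dper T (X Z a b ↦ Σ' n, W u (u′+T∘n) X Z a b)) X Z a b` — under FINITE SUPPORT of the summand family
# (the packed sym family's windows; a `Summable` version is the same proof with the three section letters displayed)

WHY (`HOME/b2b-balaban-beta-d1-p3/g43/SPEC-55.md` §6; an2 g67 A-2 l.67742 «the road's proposal is ACCEPTED — the road types the generic bridge + slot bridge as §3 of
`TowerQN2Row`»).  Road (F) `TowerQN2RowJunction` put v5's row `hQN₂`'s LEFT side in product form against F5-Sym's triple copy sum of leaf-02's packed sym family; an2's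
PART 14b puts the RIGHT side (sector by sector) in product form against `perF T (dper T (second-bond copy sum of a table))`.  This file is the re-indexing between the
two: substitution `(m₁, m₂, m) ↦ (k, n, j) = (−m₁, m₂ − m₁, m)` (an `Equiv` of `(ℤ^{d+1})³`) by the joint covariance, and ONE Fubini on the triple product (the nestings
are `(m₁, m₂, m)` on the left and `(j, k, n)` in `perZ ∘ dper ∘ Σ'`), under finite support (all sections finite).
WHAT ([folklore] `tsum` bookkeeping; no `def`, no `def … : Prop`, nothing cited, 0 sorry; generic `d`, `F`): §1 `finite_support_section` (GAN24 `translate_zero` reused),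
`tsum₃_eq_tsum_prod` (a finitely supported function on `β × (γ × δ)`: the iterated triple `Σ'` is the `Σ'` over the product — `Summable.tsum_prod'` twice);
§2 `copies_term_eq` (the covariance re-indexing of ONE term), **`tsum₃_translate_eq_perZ_dper_tsum`** (the bridge).
NOT HERE: the finite-support letter for the packed sym family (its windows, F5-Sym's `compVH2Ker_eq_zero_*` — in `TowerQN2Row`), the slot bridge (#4 `perZ_dper_wrapPt_left`),
the sector table words (an2).  Nothing of Bałaban's asserted; 0 estimates; NOT (C1), NOT D1, NOT BetaPertH, NOT continuum, NOT Clay.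

HONEST DEPENDENCY (page 1, mandatory): continuum YM on T⁴ ⇐ BetaPertH ∧ nine spine estimates (0/9 proved); BetaPertH ⇐ (D1) ∧ (D4) ∧ CAP+tail;
G-an2-4 gates asym, D1 and NE2/3/4.  HONEST FRAMING (cell contract, verbatim): «discharging `BetaPertH` makes Bałaban's UV stability UNCONDITIONAL —
a real constructive-QFT result; it is NOT the continuum limit and NOT the Clay problem.»  ABSOLUTE RULE (cell charter, verbatim): «No internally-minted
statement may enter as a cited fact. Every hypothesis is either kernel-proved in this package or a verbatim quotation of a PUBLISHED theorem with page
reference. The manuscript(s) under audit are NOT citable for their own disputed steps — they are the thing under adjudication; programme-internal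
(2001/route/tribunal) claims are never citable.»  Road «FP» OWNER, b2b-balaban-beta-d1-p3 gen 43, 2026-08-27.  No existing file touched.
-/

noncomputable section

open scoped BigOperators

namespace Summit.QuantumFields.BalabanUV.Beta.FP.KernelPeriodisationCopySums

open Literature.MathematicalPhysics.QuantumFieldTheory.Balaban1983to89
open Literature.MathematicalPhysics.QuantumFieldTheory.Balaban1983to89.Beta
open B4TorusKernel.MultiPeriod (translate)
open B4Reflection242 (translate_translate)
open Summit.QuantumFields.BalabanUV.Beta.GAN24.DirichletExhaustionDeperiodise (translate_zero)
open ExpKernelCalculus (MKer)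
open Summit.QuantumFields.BalabanUV.Beta.FP.KernelPeriodisationFib (perZ perZ_apply)
open Summit.QuantumFields.BalabanUV.Beta.FP.KernelPeriodisationFibLoc (dper dper_apply)

variable {d : ℕ} {F : Type*}

/-! ## §1 Letters: sections of finitely supported functions, the triple `Σ'` as a product `Σ'` -/

section Letters

/-- [folklore] a section `q ↦ G (k, q)` of a finitely supported `G : β × γ → ℝ` is finitely supported. -/
theorem finite_support_section {β γ : Type*} {G : β × γ → ℝ} (h : (Function.support G).Finite) (k : β) :
    (Function.support fun q : γ => G (k, q)).Finite :=
  (h.image Prod.snd).subset fun q hq => ⟨(k, q), hq, rfl⟩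

/-- [folklore] **the iterated triple `Σ'` of a finitely supported function on `β × (γ × δ)` is its `Σ'` over the product** (`Summable.tsum_prod'` twice; every
section is finitely supported). -/
theorem tsum₃_eq_tsum_prod {β γ δ : Type*} (G : β × (γ × δ) → ℝ) (h : (Function.support G).Finite) :
    (∑' k, ∑' n, ∑' j, G (k, (n, j))) = ∑' p, G p := by
  have h1 : ∀ k, (Function.support fun q : γ × δ => G (k, q)).Finite := fun k => finite_support_section h k
  have h2 : ∀ k n, (Function.support fun j : δ => G (k, (n, j))).Finite := fun k n => finite_support_section (h1 k) n
  rw [(summable_of_hasFiniteSupport h).tsum_prod' fun k => summable_of_hasFiniteSupport (h1 k)]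
  refine tsum_congr fun k => ?_
  exact ((summable_of_hasFiniteSupport (h1 k)).tsum_prod' fun n => summable_of_hasFiniteSupport (h2 k n)).symm

end Letters

/-! ## §2 The bridge -/

section Bridge

variable (T : Fin (d + 1) → ℕ) (W : (Fin (d + 1) → ℤ) → (Fin (d + 1) → ℤ) → MKer (d + 1) F)
  (hW : ∀ (t u u' X Z : Fin (d + 1) → ℤ) (a b : F),
    W (translate T u t) (translate T u' t) (translate T X t) (translate T Z t) a b = W u u' X Z a b)

include hW in
/-- [folklore] **ONE copy term re-indexed by the joint covariance**: `W (u+T∘m₁) (u′+T∘m₂) X (Z+T∘m) = W u (u′+T∘(m₂−m₁)) (X+T∘(−m₁)) ((Z+T∘m)+T∘(−m₁))`. -/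
theorem copies_term_eq (u u' X Z m₁ m₂ m : Fin (d + 1) → ℤ) (a b : F) :
    W (translate T u m₁) (translate T u' m₂) X (translate T Z m) a b
      = W u (translate T u' (m₂ - m₁)) (translate T X (-m₁)) (translate T (translate T Z m) (-m₁)) a b := by
  rw [← hW m₁ u (translate T u' (m₂ - m₁)) (translate T X (-m₁)) (translate T (translate T Z m) (-m₁)) a b]
  simp only [translate_translate, sub_add_cancel, neg_add_cancel, neg_add_cancel_right, translate_zero]

include hW in
/-- [folklore] **`tsum₃_translate_eq_perZ_dper_tsum` — THE BRIDGE**: for a jointly `Tℤ^{d+1}`-covariant two-bond family whose copy family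
`(k, n, j) ↦ W u (u′+T∘n) (X+T∘k) ((Z+T∘j)+T∘k) a b` is finitely supported,
`Σ'_{m₁} Σ'_{m₂} Σ'_m W (u+T∘m₁) (u′+T∘m₂) X (Z+T∘m) a b = perZ T (dper T (X Z a b ↦ Σ' n, W u (u′+T∘n) X Z a b)) X Z a b`. -/
theorem tsum₃_translate_eq_perZ_dper_tsum (u u' X Z : Fin (d + 1) → ℤ) (a b : F)
    (hfin : (Function.support fun p : (Fin (d + 1) → ℤ) × ((Fin (d + 1) → ℤ) × (Fin (d + 1) → ℤ)) =>
      W u (translate T u' p.2.1) (translate T X p.1) (translate T (translate T Z p.2.2) p.1) a b).Finite) :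
    (∑' m₁ : Fin (d + 1) → ℤ, ∑' m₂ : Fin (d + 1) → ℤ, ∑' m : Fin (d + 1) → ℤ, W (translate T u m₁) (translate T u' m₂) X (translate T Z m) a b)
      = perZ T (dper T (fun X' Z' a' b' => ∑' n : Fin (d + 1) → ℤ, W u (translate T u' n) X' Z' a' b')) X Z a b := by
  -- the copy family on the triple product, indexed `(k, (n, j))`
  set G : (Fin (d + 1) → ℤ) × ((Fin (d + 1) → ℤ) × (Fin (d + 1) → ℤ)) → ℝ :=
    fun p => W u (translate T u' p.2.1) (translate T X p.1) (translate T (translate T Z p.2.2) p.1) a b with hG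
  -- the two re-indexings of the triple product
  let eL : (Fin (d + 1) → ℤ) × ((Fin (d + 1) → ℤ) × (Fin (d + 1) → ℤ)) ≃ (Fin (d + 1) → ℤ) × ((Fin (d + 1) → ℤ) × (Fin (d + 1) → ℤ)) :=
    { toFun := fun r => (-r.1, (r.2.1 - r.1, r.2.2))
      invFun := fun p => (-p.1, (p.2.1 - p.1, p.2.2))
      left_inv := fun r => by simp
      right_inv := fun p => by simp }
  let eR : (Fin (d + 1) → ℤ) × ((Fin (d + 1) → ℤ) × (Fin (d + 1) → ℤ)) ≃ (Fin (d + 1) → ℤ) × ((Fin (d + 1) → ℤ) × (Fin (d + 1) → ℤ)) :=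
    { toFun := fun q => (q.2.1, (q.2.2, q.1))
      invFun := fun p => (p.2.2, (p.1, p.2.1))
      left_inv := fun q => rfl
      right_inv := fun p => rfl }
  -- finite support transports along the equivalences
  have hfinL : (Function.support (G ∘ eL)).Finite := by
    rw [Function.support_comp_eq_preimage]; exact hfin.preimage eL.injective.injOn
  have hfinR : (Function.support (G ∘ eR)).Finite := by
    rw [Function.support_comp_eq_preimage]; exact hfin.preimage eR.injective.injOn
  -- LEFT: termwise covariance, then the product sum
  have hL : (∑' m₁ : Fin (d + 1) → ℤ, ∑' m₂ : Fin (d + 1) → ℤ, ∑' m : Fin (d + 1) → ℤ, W (translate T u m₁) (translate T u' m₂) X (translate T Z m) a b)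
      = ∑' r, (G ∘ eL) r := by
    rw [← tsum₃_eq_tsum_prod (G ∘ eL) hfinL]
    refine tsum_congr fun m₁ => tsum_congr fun m₂ => tsum_congr fun m => ?_
    rw [copies_term_eq T W hW]
    rfl
  -- RIGHT: unfold `perZ ∘ dper ∘ Σ'`, then the product sum
  have hR : perZ T (dper T (fun X' Z' a' b' => ∑' n : Fin (d + 1) → ℤ, W u (translate T u' n) X' Z' a' b')) X Z a b = ∑' q, (G ∘ eR) q := by
    rw [← tsum₃_eq_tsum_prod (G ∘ eR) hfinR, perZ_apply]
    refine tsum_congr fun j => ?_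
    rw [dper_apply]
    rfl
  rw [hL, hR]
  exact (eL.tsum_eq G).trans (eR.tsum_eq G).symm

end Bridge

end Summit.QuantumFields.BalabanUV.Beta.FP.KernelPeriodisationCopySums

end
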